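import Mathlib

/-!
# Axial quadratic rigidity (stub S2q of line `axis-sectors`, crux `MomentParity.QuarticGate`):
# Hessians of homogeneous quadratics, and polarisation/complexification of vanishing forms

Two small generic tools of the reduction of `stub_axialQuadRigidity` to its algebraic core:

* the HESSIAN of a homogeneous quadratic real polynomial `P`: `hᵢⱼ = coeff 0 (∂ⱼ∂ᵢP)` is symmetric,
  `∂ᵢP(x) = Σⱼ hᵢⱼ xⱼ` and `P(x) = ½ Σᵢⱼ hᵢⱼ xᵢ xⱼ` (Euler's identity twice);
* POLARISATION + COMPLEXIFICATION: a complex-trilinear (resp. bilinear) form whose diagonal vanishes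
  on an additively closed set `A` has vanishing symmetrisation on triples (pairs) of vectors of the
  form `a + I • a'`, `a, a' ∈ A` — this is how the Casimir identity and the shear invariance, known on
  REAL (conjugate-symmetric) coefficient families, are probed with one-sided complex families.
-/

namespace Summit.AnomalousDissipation.AnomalousDissipation.Theorems.MomentParityQuarticGate.AxialQuad

-- `Summit.<Summit>.<Problem>` is the tree's mandated summit-side namespace (CONVENTIONS §2); for this
-- single-conjunct summit the two coincide, so the duplicate is deliberate.
set_option linter.dupNamespace false

/-! ## Hessians of homogeneous quadratics -/

section Hessian

open MvPolynomial

variable {m : ℕ}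

/-- **Mixed partial derivatives of polynomials commute.** [folklore] -/
theorem pderiv_comm (P : MvPolynomial (Fin m) ℝ) (i j : Fin m) :
    pderiv i (pderiv j P) = pderiv j (pderiv i P) := by
  induction P using MvPolynomial.induction_on' with
  | monomial s a =>
    rw [pderiv_monomial, pderiv_monomial, pderiv_monomial, pderiv_monomial, tsub_right_comm]
    congr 1
    by_cases hij : i = j
    · subst hij; rfl
    · rw [Finsupp.tsub_apply, Finsupp.tsub_apply, Finsupp.single_eq_of_ne hij,
        Finsupp.single_eq_of_ne (Ne.symm hij), tsub_zero, tsub_zero]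
      ring
  | add p q hp hq => rw [map_add, map_add, map_add, map_add, hp, hq]

/-- A homogeneous polynomial of degree `0` is the constant `coeff 0`. [folklore] -/
theorem eq_C_of_isHomogeneous_zero {φ : MvPolynomial (Fin m) ℝ} (h : φ.IsHomogeneous 0) :
    φ = C (φ.coeff 0) :=
  totalDegree_eq_zero_iff_eq_C.1 ((totalDegree_zero_iff_isHomogeneous _).2 h)

/-- **A linear form is the combination of its coefficients**: for `φ` homogeneous of degree `1`,
`φ(x) = Σⱼ coeff 0 (∂ⱼφ) · xⱼ`. [folklore] -/
theorem eval_of_isHomogeneous_one {φ : MvPolynomial (Fin m) ℝ} (h : φ.IsHomogeneous 1) (x : Fin m → ℝ) :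
    eval x φ = ∑ j, (pderiv j φ).coeff 0 * x j := by
  have heuler := h.sum_X_mul_pderiv
  rw [one_smul] at heuler
  conv_lhs => rw [← heuler]
  rw [map_sum]
  refine Finset.sum_congr rfl fun j _ => ?_
  have h0 : (pderiv j φ).IsHomogeneous 0 := by simpa using h.pderiv (i := j)
  rw [map_mul, eval_X, eq_C_of_isHomogeneous_zero h0, eval_C, coeff_C, if_pos rfl, mul_comm]

/-- **The gradient of a homogeneous quadratic is linear**: `∂ᵢP(x) = Σⱼ hᵢⱼ xⱼ` with the Hessian
`hᵢⱼ = coeff 0 (∂ⱼ∂ᵢP)`. [folklore] -/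
theorem eval_pderiv_of_isHomogeneous_two {P : MvPolynomial (Fin m) ℝ} (hP : P.IsHomogeneous 2)
    (x : Fin m → ℝ) (i : Fin m) :
    eval x (pderiv i P) = ∑ j, (pderiv j (pderiv i P)).coeff 0 * x j :=
  eval_of_isHomogeneous_one (by simpa using hP.pderiv (i := i)) x

/-- **Euler for quadratics**: `P(x) = ½ Σᵢⱼ hᵢⱼ xᵢ xⱼ`. [folklore] -/
theorem eval_of_isHomogeneous_two {P : MvPolynomial (Fin m) ℝ} (hP : P.IsHomogeneous 2) (x : Fin m → ℝ) :
    eval x P = 2⁻¹ * ∑ i, ∑ j, (pderiv j (pderiv i P)).coeff 0 * x i * x j := by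
  have heuler := congrArg (eval x) hP.sum_X_mul_pderiv
  rw [map_nsmul, map_sum] at heuler
  simp_rw [map_mul, eval_X, eval_pderiv_of_isHomogeneous_two hP, Finset.mul_sum] at heuler
  rw [nsmul_eq_mul, Nat.cast_ofNat] at heuler
  have : (∑ i, ∑ j, (pderiv j (pderiv i P)).coeff 0 * x i * x j) =
      ∑ i, ∑ j, x i * ((pderiv j (pderiv i P)).coeff 0 * x j) :=
    Finset.sum_congr rfl fun i _ => Finset.sum_congr rfl fun j _ => by ring
  rw [this, heuler, ← mul_assoc, inv_mul_cancel₀ two_ne_zero, one_mul]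

/-- **The Hessian is symmetric.** [folklore] -/
theorem hessian_symm (P : MvPolynomial (Fin m) ℝ) (i j : Fin m) :
    (pderiv j (pderiv i P)).coeff 0 = (pderiv i (pderiv j P)).coeff 0 := by
  rw [pderiv_comm]

end Hessian

/-! ## Polarisation and complexification of vanishing multilinear forms -/

section Polar

variable {X : Type*} [AddCommGroup X] [Module ℂ X]

/-- **Polarisation + complexification, trilinear.** Let `T` be complex-trilinear and `A ⊆ X` closed
under addition with `T(c,c,c) = 0` for `c ∈ A`. Then the symmetrisation of `T` vanishes on every
triple of vectors `a + I • a'` (`a, a' ∈ A`). [folklore] -/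
theorem trilinear_symm_sum_eq_zero (T : X → X → X → ℂ)
    (ha₁ : ∀ x x' y z, T (x + x') y z = T x y z + T x' y z)
    (ha₂ : ∀ x y y' z, T x (y + y') z = T x y z + T x y' z)
    (ha₃ : ∀ x y z z', T x y (z + z') = T x y z + T x y z')
    (hs₁ : ∀ (t : ℂ) x y z, T (t • x) y z = t * T x y z)
    (hs₂ : ∀ (t : ℂ) x y z, T x (t • y) z = t * T x y z)
    (hs₃ : ∀ (t : ℂ) x y z, T x y (t • z) = t * T x y z)
    (A : Set X) (hA : ∀ a ∈ A, ∀ b ∈ A, a + b ∈ A) (hF : ∀ c ∈ A, T c c c = 0) {x y z : X}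
    (hx : ∃ x' ∈ A, ∃ x'' ∈ A, x = x' + Complex.I • x'')
    (hy : ∃ y' ∈ A, ∃ y'' ∈ A, y = y' + Complex.I • y'')
    (hz : ∃ z' ∈ A, ∃ z'' ∈ A, z = z' + Complex.I • z'') :
    T x y z + T x z y + T y x z + T y z x + T z x y + T z y x = 0 := by
  have key : ∀ a ∈ A, ∀ b ∈ A, ∀ c ∈ A,
      T a b c + T a c b + T b a c + T b c a + T c a b + T c b a = 0 := by
    intro a ha b hb c hc
    have h1 := hF (a + b + c) (hA _ (hA a ha b hb) c hc)
    have h2 := hF (a + b) (hA a ha b hb)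
    have h3 := hF (a + c) (hA a ha c hc)
    have h4 := hF (b + c) (hA b hb c hc)
    have h5 := hF a ha
    have h6 := hF b hb
    have h7 := hF c hc
    simp only [ha₁, ha₂, ha₃] at h1 h2 h3 h4
    linear_combination h1 - h2 - h3 - h4 + h5 + h6 + h7
  obtain ⟨x', hx', x'', hx'', rfl⟩ := hx
  obtain ⟨y', hy', y'', hy'', rfl⟩ := hy
  obtain ⟨z', hz', z'', hz'', rfl⟩ := hz
  have e1 := key x' hx' y' hy' z' hz'
  have e2 := key x'' hx'' y' hy' z' hz'
  have e3 := key x' hx' y'' hy'' z' hz'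
  have e4 := key x' hx' y' hy' z'' hz''
  have e5 := key x'' hx'' y'' hy'' z' hz'
  have e6 := key x'' hx'' y' hy' z'' hz''
  have e7 := key x' hx' y'' hy'' z'' hz''
  have e8 := key x'' hx'' y'' hy'' z'' hz''
  simp only [ha₁, ha₂, ha₃, hs₁, hs₂, hs₃]
  linear_combination e1 + Complex.I * e2 + Complex.I * e3 + Complex.I * e4 +
    Complex.I ^ 2 * e5 + Complex.I ^ 2 * e6 + Complex.I ^ 2 * e7 + Complex.I ^ 3 * e8

/-- **Polarisation + complexification, bilinear.** [folklore] -/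
theorem bilinear_symm_sum_eq_zero (D : X → X → ℂ)
    (ha₁ : ∀ x x' y, D (x + x') y = D x y + D x' y) (ha₂ : ∀ x y y', D x (y + y') = D x y + D x y')
    (hs₁ : ∀ (t : ℂ) x y, D (t • x) y = t * D x y) (hs₂ : ∀ (t : ℂ) x y, D x (t • y) = t * D x y)
    (A : Set X) (hA : ∀ a ∈ A, ∀ b ∈ A, a + b ∈ A) (hF : ∀ c ∈ A, D c c = 0) {x y : X}
    (hx : ∃ x' ∈ A, ∃ x'' ∈ A, x = x' + Complex.I • x'')
    (hy : ∃ y' ∈ A, ∃ y'' ∈ A, y = y' + Complex.I • y'') : D x y + D y x = 0 := by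
  have key : ∀ a ∈ A, ∀ b ∈ A, D a b + D b a = 0 := by
    intro a ha b hb
    have h1 := hF (a + b) (hA a ha b hb)
    have h2 := hF a ha
    have h3 := hF b hb
    simp only [ha₁, ha₂] at h1
    linear_combination h1 - h2 - h3
  obtain ⟨x', hx', x'', hx'', rfl⟩ := hx
  obtain ⟨y', hy', y'', hy'', rfl⟩ := hy
  have e1 := key x' hx' y' hy'
  have e2 := key x'' hx'' y' hy'
  have e3 := key x' hx' y'' hy''
  have e4 := key x'' hx'' y'' hy''
  simp only [ha₁, ha₂, hs₁, hs₂]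
  linear_combination e1 + Complex.I * e2 + Complex.I * e3 + Complex.I ^ 2 * e4

end Polar

end Summit.AnomalousDissipation.AnomalousDissipation.Theorems.MomentParityQuarticGate.AxialQuad

namespace Summit.AnomalousDissipation.AnomalousDissipation.Theorems.MomentParityQuarticGate

-- the summit-side namespace repeats `AnomalousDissipation` by the tree's convention
set_option linter.dupNamespace false in
/-- **Registered sub-goal `axialQuad_hessian_eval` of stub S2q** (summary of this file): the gradient of a homogeneous quadratic is linear, `∂ᵢP(x) = Σⱼ hᵢⱼ xⱼ`. [folklore] -/
theorem axialQuad_hessian_eval : ∀ (m : ℕ) (P : MvPolynomial (Fin m) ℝ), P.IsHomogeneous 2 → ∀ (x : Fin m → ℝ) (i : Fin m), MvPolynomial.eval x (MvPolynomial.pderiv i P) = ∑ j, (MvPolynomial.pderiv j (MvPolynomial.pderiv i P)).coeff 0 * x j :=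
  fun _ _ hP x i => AxialQuad.eval_pderiv_of_isHomogeneous_two hP x i

end Summit.AnomalousDissipation.AnomalousDissipation.Theorems.MomentParityQuarticGate
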